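import Summits.HodgeConjecture.HodgeConjecture.Theorems.Ring2AbelianAllFrame
import Summits.HodgeConjecture.HodgeConjecture.Theorems.Ring2AbelianAllWeilFloor
import Summits.HodgeConjecture.HodgeConjecture.Theorems.WeilTypeLadderCMReduction
import HarnessLib

/-!
# Ring 2 · AbelianAll · the WEIL COLUMN placed in the sub-cell's grammar (seat `pub-hodge-ring2-ab-weil-1`, gen 2)

research route, not a corollary; conditional on HC_CM plus one named minimal statement.
Cell line: research route conditional on HC_CM; not a corollary; Q11.4-sentence-2 already refuted in dim ≥ 3.

Nothing in this file proves a case of the Hodge conjecture. Every Weil rung (`WeilTypeLadder.WeilClassesImaginaryQuadratic`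
= R∞, `WeilTypeLadder.WeilClassesCMField` = R3, `AbelianAll.WeilFourfoldResidual` = R1), `HC_CM`
(= `Theses.RankFourFaces.CMAbelianHodge`), `HC_AV` (= `Theses.PadicSemiregularLift.HodgeAbelianVarieties`) and every
candidate `B` of the LEAD grammar (`Theorems/Ring2AbelianAllFrame.lean`) is a HYPOTHESIS wherever it occurs; the printed
input is André's 1992 theorem, the NAMED FACT `Andre1992_hodgeClasses_cmAbelianVariety_mem_span_pullback_weilClasses`
(refereed; Charles–Schnell 2014 Thm. 11.5.21), consumed BY NAME through the hweil edge
`WeilTypeLadder.rankFourFaces_cmAbelianHodge_of_andre_of_rungs : [André 1992] → R∞ → R3 → HC_CM` — nothing re-vendored.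

## What is placed (LEAD ruling AB.F3 (R3): owners place their column by name, one line each)

* ON PATH. The Weil column is a consequence of `HC_AV` with no input: `onPathAV_weilClassesImaginaryQuadratic`,
  `onPathAV_weilClassesCMField`, `onPathAV_weilFourfoldResidual` (every Weil-type variety is an abelian variety).
* THE WEIL RUNGS DOMINATE `HC_CM` (André 1992, kernel edge of the hweil ladder), hence every closing row
  `ClosesWithCM B : HC_CM → B → HC_AV` of the grammar has an **`HC_CM`-FREE TWIN** `R∞ → R3 → B → HC_AV` modulo the one
  refereed fact (`HC_AV_of_closesWithCM_of_weilRungs`); in the grammar's own words `CMIdle (R∞ ∧ R3 ∧ B)`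
  (`cmIdle_weilRungs_and_of_closesWithCM`) and, for exact `B`, `HC_AV ↔ R∞ ∧ R3 ∧ B` (`iff_weilRungs_and_of_exactWithCM`).
  Instances by name: `B = (4) CMAnchoredTransport` [mod Lemme 6.3.1] and the fact-free `B = (T∃) CMAnchoredPencilTransport`.
* The residual of the dim ≤ 5 floor is a slice of R∞ (`weilFourfoldResidual_of_weilClassesImaginaryQuadratic`).

HONEST: the twin rows trade the hypothesis `HC_CM` for the two OPEN Weil rungs R∞ ∧ R3 (each a case of HC, each open in
print beyond the fourfold / hyperbolic-sixfold floor); they are weaker-hypothesis only in the sense "cases of HC on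
Weil-type abelian varieties instead of all CM abelian varieties", which is André's theorem and nothing of ours. KIND of
`HC_CM` next to `R∞ ∧ R3 ∧ B`: idle (typed dominator = André 1992). No minimality is claimed for anything.
-/

noncomputable section

set_option linter.dupNamespace false

namespace Summit.HodgeConjecture.HodgeConjecture.Ring2.AbelianAll

open CategoryTheory
open Literature.AlgebraicGeometry Literature.AlgebraicGeometry.Motives
open Literature.AlgebraicGeometry.HodgeTheory
open Literature.AlgebraicGeometry.Andre1996 (andre1996_cmAnchoredPencil)
open Summit.HodgeConjecture.HodgeConjecture
open Summit.HodgeConjecture.HodgeConjecture.Theses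
open Summit.HodgeConjecture.HodgeConjecture.Theses.RankFourFaces (CMAbelianHodge CMToAbelian)
open Summit.HodgeConjecture.HodgeConjecture.Theses.PadicSemiregularLift (HodgeAbelianVarieties)
open Summit.HodgeConjecture.HodgeConjecture.WeilTypeLadder
open Summit.HodgeConjecture.HodgeConjecture.Ring2.Hypotheses

/-! ### §1 The Weil column is ON PATH (consequences of `HC_AV`, no input) -/

/-- R∞ (Weil classes, imaginary quadratic `K`, every `n ≥ 2`, every discriminant) is a consequence of `HC_AV`:
a Weil-type `2n`-fold is an abelian variety. [cite: Weil1977HodgeRing] -/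
theorem onPathAV_weilClassesImaginaryQuadratic : OnPathAV WeilClassesImaginaryQuadratic :=
  fun hAV n _ _ _ A _ hA _ _ c hc hnn _ ↦ by
    have h : HodgeConjectureFor A.dim A.X := hAV A
    rw [hA] at h
    exact h.2 n c hc hnn

/-- R3 (Weil classes for a CM field `K`, `[K:ℚ] > 2`) is a consequence of `HC_AV`. [cite: MoonenZarhin1998WeilClasses, §1] -/
theorem onPathAV_weilClassesCMField : OnPathAV WeilClassesCMField :=
  fun hAV A _ _ _ m _ _ _ _ _ _ _ _ c _ hc hmm ↦ (hAV A).2 m c hc hmm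

/-- The residual R1 of the dim ≤ 5 floor is a slice of R∞. [cite: vanGeemen1994HodgeAV, 5.2–5.4] -/
theorem weilFourfoldResidual_of_weilClassesImaginaryQuadratic (h : WeilClassesImaginaryQuadratic) :
    WeilFourfoldResidual :=
  fun _d hd _ _ δ _ ↦ weilClassesComponent_of_weilClassesImaginaryQuadratic h le_rfl hd δ

/-- The residual R1 is a consequence of `HC_AV` (through R∞). [cite: Deligne2000, §1] -/
theorem onPathAV_weilFourfoldResidual : OnPathAV WeilFourfoldResidual :=
  onPathAV_monotone weilFourfoldResidual_of_weilClassesImaginaryQuadratic onPathAV_weilClassesImaginaryQuadratic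

/-! ### §2 The Weil rungs dominate `HC_CM` (André 1992): `HC_CM`-free twins of the grammar's closing rows -/

/-- **`HC_CM`-FREE TWIN of a closing row.** If `HC_CM → B → HC_AV` (the grammar's `ClosesWithCM B`), then
`R∞ → R3 → B → HC_AV` modulo André's 1992 theorem (named fact, by name through the hweil edge
`rankFourFaces_cmAbelianHodge_of_andre_of_rungs`). [cite: Andre1992HodgeCM, Théorème]
[cite: CharlesSchnell2014Notes, Thm. 11.5.21 (p. 510)] -/
theorem HC_AV_of_closesWithCM_of_weilRungs {B : Prop} (hB : ClosesWithCM B)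
    (hA : Andre1992_hodgeClasses_cmAbelianVariety_mem_span_pullback_weilClasses)
    (h₂ : WeilClassesImaginaryQuadratic) (h₃ : WeilClassesCMField) (b : B) : HodgeAbelianVarieties :=
  hB (rankFourFaces_cmAbelianHodge_of_andre_of_rungs hA h₂ h₃) b

/-- In the grammar's words: next to the Weil rungs, `HC_CM` is IDLE for every closing candidate — `CMIdle (R∞ ∧ R3 ∧ B)`,
the typed dominator being André 1992. [cite: Andre1992HodgeCM, Théorème] -/
theorem cmIdle_weilRungs_and_of_closesWithCM {B : Prop} (hB : ClosesWithCM B)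
    (hA : Andre1992_hodgeClasses_cmAbelianVariety_mem_span_pullback_weilClasses) :
    CMIdle (WeilClassesImaginaryQuadratic ∧ WeilClassesCMField ∧ B) :=
  fun h ↦ HC_AV_of_closesWithCM_of_weilRungs hB hA h.1 h.2.1 h.2.2

/-- **Exactness with the Weil rungs in place of `HC_CM`.** For every EXACT candidate (`HC_AV ↔ HC_CM ∧ B`):
`HC_AV ↔ R∞ ∧ R3 ∧ B`, modulo André 1992. [cite: Andre1992HodgeCM, Théorème] [cite: CharlesSchnell2014Notes, Thm. 11.5.21] -/
theorem iff_weilRungs_and_of_exactWithCM {B : Prop} (hB : ExactWithCM B)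
    (hA : Andre1992_hodgeClasses_cmAbelianVariety_mem_span_pullback_weilClasses) :
    HodgeAbelianVarieties ↔ (WeilClassesImaginaryQuadratic ∧ WeilClassesCMField ∧ B) :=
  ⟨fun h ↦ ⟨onPathAV_weilClassesImaginaryQuadratic h, onPathAV_weilClassesCMField h, (exactWithCM_iff.1 hB).2 h⟩,
    cmIdle_weilRungs_and_of_closesWithCM (exactWithCM_iff.1 hB).1 hA⟩

/-- The Weil rungs alone close exactly the item: `R∞ → R3 → CMToAbelian → HC_AV` (least element of the grammar),
modulo André 1992. [cite: Andre1992HodgeCM, Théorème] -/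
theorem HC_AV_of_weilRungs_of_cmToAbelian
    (hA : Andre1992_hodgeClasses_cmAbelianVariety_mem_span_pullback_weilClasses)
    (h₂ : WeilClassesImaginaryQuadratic) (h₃ : WeilClassesCMField) (hT : CMToAbelian) : HodgeAbelianVarieties :=
  HC_AV_of_closesWithCM_of_weilRungs closesWithCM_cmToAbelian hA h₂ h₃ hT

/-! ### §3 Instances by name -/

/-- **Row (4), `HC_CM`-free: `HC(all AV) ⟸ R∞ + R3 + CMAnchoredTransport`**, modulo the two refereed facts André 1992
and André 1996 Lemme 6.3.1 (`HC_AV_of_HC_CM_and_Bmin` with `HC_CM` supplied by the Weil rungs). Binder count: 2 refereed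
named facts + 0 typed obligations + 0 inferences + 3 open hypotheses (R∞, R3, (4)) + 0 `HC_CM`.
[cite: Andre1996Motifs, Lemme 6.3.1 (p. 31)] [cite: Andre1992HodgeCM, Théorème] -/
theorem HC_AV_of_weilRungs_and_cmAnchoredTransport (h₂₁ : andre1996_cmAnchoredPencil)
    (hA : Andre1992_hodgeClasses_cmAbelianVariety_mem_span_pullback_weilClasses)
    (h₂ : WeilClassesImaginaryQuadratic) (h₃ : WeilClassesCMField) (hT : CMAnchoredTransport) :
    HodgeAbelianVarieties :=
  HC_AV_of_HC_CM_and_Bmin h₂₁ (rankFourFaces_cmAbelianHodge_of_andre_of_rungs hA h₂ h₃) hT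

/-- **Row (T∃), `HC_CM`-free and 6.3.1-free: `HC(all AV) ⟸ R∞ + R3 + CMAnchoredPencilTransport`**, modulo André 1992
only (abII's fact-free closing row `closesWithCM_cmAnchoredPencilTransport`). [cite: Andre1992HodgeCM, Théorème] -/
theorem HC_AV_of_weilRungs_and_cmAnchoredPencilTransport
    (hA : Andre1992_hodgeClasses_cmAbelianVariety_mem_span_pullback_weilClasses)
    (h₂ : WeilClassesImaginaryQuadratic) (h₃ : WeilClassesCMField) (hT : CMAnchoredPencilTransport) :
    HodgeAbelianVarieties :=
  HC_AV_of_closesWithCM_of_weilRungs closesWithCM_cmAnchoredPencilTransport hA h₂ h₃ hT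

/-- Exactness instance: `HC_AV ↔ R∞ ∧ R3 ∧ CMToAbelian`, modulo André 1992. [cite: Andre1992HodgeCM, Théorème] -/
theorem iff_weilRungs_and_cmToAbelian
    (hA : Andre1992_hodgeClasses_cmAbelianVariety_mem_span_pullback_weilClasses) :
    HodgeAbelianVarieties ↔ (WeilClassesImaginaryQuadratic ∧ WeilClassesCMField ∧ CMToAbelian) :=
  iff_weilRungs_and_of_exactWithCM exactWithCM_cmToAbelian hA

/-! ### §4 Summit audit -/

/-- Everything here follows from the Hodge conjecture (upper bound; the rows are ON PATH). [cite: Deligne2000, §1] -/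
theorem weilColumn_of_hodgeConjecture (h : _root_.HodgeConjecture) :
    WeilClassesImaginaryQuadratic ∧ WeilClassesCMField ∧ WeilFourfoldResidual :=
  ⟨weilClassesImaginaryQuadratic_of_hodgeConjecture h, weilClassesCMField_of_hodgeConjecture h,
    weilFourfoldResidual_of_hodgeConjecture h⟩

end Summit.HodgeConjecture.HodgeConjecture.Ring2.AbelianAll

end
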